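import Literature.MathematicalPhysics.QuantumFieldTheory.Balaban1983to89.B12Spaces329NearSharp
import Literature.MathematicalPhysics.QuantumFieldTheory.Balaban1983to89.B13Space134
import Mathlib.Analysis.CStarAlgebra.Matrix

/-!
# `Balaban1983to89.B12RegularSpaces111Unitary` — T. Bałaban, *Renormalization group approach to lattice gauge field theories. I*,
Commun. Math. Phys. **109** (1987) 249–301 [Balaban1987RG1], p. 252: the VALUE DATA of the concrete regular spaces (`B12RegularSpaces111.Model`:
the compact group `G`, its complexification `Gᶜ`, the complexified Lie algebra `𝔤ᶜ`) INSTANTIATED for print's ambient example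
«G ⊂ U(N)» at `G = U(N)`: `G` = the unitary elements, `Gᶜ` = all invertible elements (`GL(N, ℂ)`), `𝔤ᶜ` = everything (`M_N(ℂ) = 𝔲(N)ᶜ`),
in any C⋆-algebra `𝔸` — and the standing MODEL HYPOTHESES of the concrete-spaces lineage (`‖·‖ ≤ 1` on `G`, `G ≤ Gᶜ`, `𝔤ᶜ` `Ad(G)`-stable,
`Ad(exp iξE)`-stable and closed under `newPot`, `exp iξE ∈ Gᶜ`) DISCHARGED for it, so that the `G`-invariance of (i)–(iii)/(3.16)/(1.34) and
the near-`G` clause of (3.29) hold HYPOTHESIS-FREE in this model (PROVED)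

HONEST FRAMING (cell `lit-balaban`, verbatim): statement-level skeleton of published theorems with citation tags; proofs where landed; nothing here is a claim about the Yang–Mills mass gap.

PDF held: `paper:balaban1987-cmp109-rg-i-small-field` (journal page = PDF page + 248); pp. 251–252 (PDF 3–4) and p. 262 read from the
text layer.

WHAT IS REPRODUCED.  Nothing of the paper is asserted.  The concrete-spaces lineage (p07 gens 2–5: `B12RegularSpaces111(Gauge|Mono)`,
`B12Spaces329NearBond/Near/BCH/NearSharp`, `B13Space134`, `B14RegularSpaces234(Gauge)`, `B14Space343`) carries the group data as an
ABSTRACT record `Model 𝔸 = ⟨G, Gᶜ, 𝔤ᶜ⟩` of sub-objects of a complete normed `ℂ`-algebra `𝔸`, and every invariance theorem there takes the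
elementary properties of print's groups as HYPOTHESES (`hG1 : ‖g‖ ≤ 1 on G`, `hGc : G ≤ Gᶜ`, `hgc : Ad(G)𝔤ᶜ ⊆ 𝔤ᶜ`, and for the near-`G`
clause `hgcN`/`heGc`/`hgcE`).  This file supplies the MODEL INSTANCE the referee protocol asks for (G.1 «model-instance»; rows
`B12.Eq1.11-1.14`, `B12.Eq3.15-3.16`, `B12.Eq3.28-3.29`, `B13.Lem2`): for 𝔸 a C⋆-algebra (print: `𝔸 = M_N(ℂ)` with the operator norm
(0.19) of [Balaban1985Averaging]; in Lean `Matrix (Fin N) (Fin N) ℂ` under the scope `Matrix.Norms.L2Operator`, §4), `unitaryModel 𝔸 :=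
⟨unitary elements, ⊤, ⊤⟩` is the `U(N)` case of p. 252, for which the hypotheses are TRUE (`unitaryModel_norm_le` from the C⋆-identity,
the rest trivially since `Gᶜ` and `𝔤ᶜ` are everything), whence the hypothesis-free corollaries of §3.  HONEST SCOPE: print's `G` is a
SEMISIMPLE compact `G ⊂ U(N)` (p. 251–252; e.g. `SU(N)`, `Gᶜ = SL(N, ℂ)`, `𝔤ᶜ = 𝔰𝔩(N, ℂ)`), and p. 252 adds «In fact a bigger part of our
considerations does not depend on the semisimplicity assumption»; `U(N)` itself is not semisimple.  The `SU(N)`-model (closure of the BCH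
composition `newPot` under trace zero, `Ad`-stability of `𝔰𝔩`) is NOT typed here — successor item (cf. the pub-balaban lineage
`B13Inv214OrbitSUN.slUnits` for `SL(N, ℂ)` as a subgroup of units).  No `Prop` placeholder, no new fact; two definitions with bodies
(`unitaryUnits`, `unitaryModel`); axioms standard.  Unit `lit-balaban-p07` (Phase-2 seat p07 gen 5; TAKING line HOME/STATUS.md
2026-08-21T06:16:00Z), HOME `run/shared/lean/pub/lit-balaban/`.

THE PRINT, verbatim (pp. 251–252): *«Field configurations have values in a compact Lie group G. … We assume that G is semisimple and that it is
a Lie subgroup of a group of complex unitary matrices, for example G ⊂ U(N). (In fact a bigger part of our considerations does not depend on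
the semisimplicity assumption.)»*; p. 252: *«For technical reasons we wish to establish analyticity with respect to group valued gauge fields.
Therefore we also consider the complexified group Gᶜ. Elements of this group are defined as matrices of the form 𝐔 = U′U, where U ∈ G and
U′ = exp iA′, A′ ∈ 𝔤ᶜ, 𝔤ᶜ is the complexification of the real Lie algebra 𝔤.»*; p. 262 (1.10)–(1.13): *«u is a Gᶜ-valued gauge transformation
… U has values in the group G … A′ has values in the algebra 𝔤ᶜ»*.
-/

namespace Literature.MathematicalPhysics.QuantumFieldTheory.Balaban1983to89.B12RegularSpaces111Unitary

open NormedSpace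
open Literature.MathematicalPhysics.QuantumFieldTheory.Balaban1983to89
open Literature.MathematicalPhysics.QuantumFieldTheory.Balaban1983to89.B12RegularSpaces111
open Literature.MathematicalPhysics.QuantumFieldTheory.Balaban1983to89.B12RegularSpaces111Gauge
open Literature.MathematicalPhysics.QuantumFieldTheory.Balaban1983to89.B12Membership313II
open Literature.MathematicalPhysics.QuantumFieldTheory.Balaban1983to89.B12Spaces329NearSharp
open Literature.MathematicalPhysics.QuantumFieldTheory.Balaban1983to89.B13Space134

noncomputable section

/-! ## §1. The unitary elements as a subgroup of units; the `U(N)`-type model -/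

section Defs

variable (𝔸 : Type*) [Monoid 𝔸] [StarMul 𝔸]

/-- The unitary elements of `𝔸` (`u⋆u = uu⋆ = 1`, Mathlib's `unitary 𝔸`; for `𝔸 = M_N(ℂ)` the group `U(N)` = `Matrix.unitaryGroup`) seen
as a subgroup of the unit group `𝔸ˣ` — print's «U has values in the group G», «G ⊂ U(N)», with configurations valued in units
(`B12RegularSpaces111`: `𝐔 : PBond → 𝔸ˣ`). [cite: Balaban1987RG1, p.252] -/
def unitaryUnits : Subgroup 𝔸ˣ where
  carrier := {u | (u : 𝔸) ∈ unitary 𝔸}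
  mul_mem' {u v} hu hv := by
    simp only [Set.mem_setOf_eq, Units.val_mul] at hu hv ⊢
    exact (unitary 𝔸).mul_mem hu hv
  one_mem' := by
    simp only [Set.mem_setOf_eq, Units.val_one]
    exact (unitary 𝔸).one_mem
  inv_mem' {u} hu := by
    simp only [Set.mem_setOf_eq] at hu ⊢
    have e : ((u⁻¹ : 𝔸ˣ) : 𝔸) = star (u : 𝔸) :=
      Units.inv_eq_of_mul_eq_one_right (Unitary.mul_star_self_of_mem hu)
    rw [e]
    exact Unitary.star_mem hu

variable {𝔸} in
/-- Membership: `u ∈ unitaryUnits 𝔸 ↔ (u : 𝔸) ∈ unitary 𝔸`. [cite: Balaban1987RG1, p.252] -/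
@[simp] theorem mem_unitaryUnits {u : 𝔸ˣ} : u ∈ unitaryUnits 𝔸 ↔ (u : 𝔸) ∈ unitary 𝔸 := Iff.rfl

end Defs

section ModelDef

variable (𝔸 : Type*) [NormedRing 𝔸] [NormedAlgebra ℂ 𝔸] [StarRing 𝔸]

/-- **The `U(N)`-type model of the value data** (p. 252 «for example G ⊂ U(N)», here WITH EQUALITY): `G` = the unitary elements of `𝔸`
(`U(N)`), `Gᶜ` = all of `𝔸ˣ` (`GL(N, ℂ) = U(N)ᶜ`), `𝔤ᶜ` = all of `𝔸` (`M_N(ℂ) = 𝔤𝔩(N, ℂ) = 𝔲(N)ᶜ`).  For `𝔸 = M_N(ℂ)` with the operator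
norm this is literally `(U(N), GL(N, ℂ), M_N(ℂ))` (§4). [cite: Balaban1987RG1, p.252] -/
def unitaryModel : Model 𝔸 where
  G := unitaryUnits 𝔸
  Gc := ⊤
  gc := ⊤

variable {𝔸} in
/-- `G` of the model is the unitary subgroup. [cite: Balaban1987RG1, p.252] -/
@[simp] theorem mem_unitaryModel_G {u : 𝔸ˣ} : u ∈ (unitaryModel 𝔸).G ↔ (u : 𝔸) ∈ unitary 𝔸 := Iff.rfl

variable {𝔸} in
/-- `Gᶜ` of the model is everything. [cite: Balaban1987RG1, p.252] -/
@[simp] theorem mem_unitaryModel_Gc (u : 𝔸ˣ) : u ∈ (unitaryModel 𝔸).Gc := Subgroup.mem_top u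

variable {𝔸} in
/-- `𝔤ᶜ` of the model is everything. [cite: Balaban1987RG1, p.252] -/
@[simp] theorem mem_unitaryModel_gc (X : 𝔸) : X ∈ (unitaryModel 𝔸).gc := Submodule.mem_top

end ModelDef

/-! ## §2. The standing model hypotheses of the lineage hold in the `U(N)`-type model -/

section Hyps

variable {𝔸 : Type*} [NormedRing 𝔸] [NormedAlgebra ℂ 𝔸] [StarRing 𝔸]

/-- **`hG1`: `‖g‖ ≤ 1` on `G`** — a unitary element of a C⋆-algebra has norm `1` (`CStarRing.norm_of_mem_unitary`; norm `0` in the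
trivial algebra). [cite: Balaban1987RG1, p.252] -/
theorem unitaryModel_norm_le [CStarRing 𝔸] : ∀ g ∈ (unitaryModel 𝔸).G, ‖(g : 𝔸)‖ ≤ 1 := by
  intro g hg
  rw [mem_unitaryModel_G] at hg
  rcases subsingleton_or_nontrivial 𝔸 with h𝔸 | h𝔸
  · rw [Subsingleton.elim (g : 𝔸) 0, norm_zero]; exact zero_le_one
  · exact (CStarRing.norm_of_mem_unitary hg).le

/-- **`hGc`: `G ≤ Gᶜ`** (`U(N) ⊂ GL(N, ℂ)`). [cite: Balaban1987RG1, p.252] -/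
theorem unitaryModel_G_le_Gc : (unitaryModel 𝔸).G ≤ (unitaryModel 𝔸).Gc := fun u _ => mem_unitaryModel_Gc u

/-- **`hgc`: `𝔤ᶜ` is `Ad(G)`-stable** (trivially: `𝔤ᶜ = M_N(ℂ)`). [cite: Balaban1987RG1, (1.10) p.262] -/
theorem unitaryModel_gc_conj : ∀ g ∈ (unitaryModel 𝔸).G, ∀ X ∈ (unitaryModel 𝔸).gc, (g : 𝔸) * X * ↑g⁻¹ ∈ (unitaryModel 𝔸).gc :=
  fun _ _ _ _ => mem_unitaryModel_gc _

/-- **`hgcN`: `𝔤ᶜ` is closed under the BCH composition `newPot`** (trivially). [cite: Balaban1987RG1, (1.13) p.262] -/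
theorem unitaryModel_gc_newPot [CompleteSpace 𝔸] :
    ∀ (ξ : ℝ) (X : 𝔸), X ∈ (unitaryModel 𝔸).gc → ∀ Y ∈ (unitaryModel 𝔸).gc, ξ * (‖X‖ + ‖Y‖) ≤ 1 / 4 →
      newPot ξ X Y ∈ (unitaryModel 𝔸).gc :=
  fun _ _ _ _ _ _ => mem_unitaryModel_gc _

/-- **`heGc`: `exp iξE(x) ∈ Gᶜ`** (trivially: `Gᶜ = GL(N, ℂ)`). [cite: Balaban1987RG1, (1.10) p.262] -/
theorem unitaryModel_expI_mem_Gc [CompleteSpace 𝔸] {S : Type*} (ξ : ℝ) (E : S → 𝔸) :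
    ∀ x, expI ξ (E x) ∈ (unitaryModel 𝔸).Gc := fun _ => mem_unitaryModel_Gc _

/-- **`hgcE`: `𝔤ᶜ` is `Ad(exp iξE)`-stable** (trivially). [cite: Balaban1987RG1, (1.10) p.262] -/
theorem unitaryModel_gc_conjE [CompleteSpace 𝔸] {S : Type*} (ξ : ℝ) (E : S → 𝔸) :
    ∀ x, ∀ X ∈ (unitaryModel 𝔸).gc, (expI ξ (E x) : 𝔸) * X * ↑(expI ξ (E x))⁻¹ ∈ (unitaryModel 𝔸).gc :=
  fun _ _ _ => mem_unitaryModel_gc _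

/-- In this model «`𝔤ᶜ`-valued» and «`Gᶜ`-valued» are vacuous: every `E` is `𝔤ᶜ`-valued. [cite: Balaban1987RG1, (1.13) p.262] -/
theorem unitaryModel_gcValued {S : Type*} (E : S → 𝔸) : ∀ x, E x ∈ (unitaryModel 𝔸).gc := fun _ => mem_unitaryModel_gc _

end Hyps

/-! ## §3. Hypothesis-free corollaries in the `U(N)`-type model -/

section Corollaries

variable {P : Params} {i : ℕ} {𝔸 : Type*} [NormedRing 𝔸] [NormedAlgebra ℂ 𝔸] [CompleteSpace 𝔸] [StarRing 𝔸] [CStarRing 𝔸]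

/-- **(i)–(iii) are invariant under `U(N)`-valued gauge transformations** (same constants) — `B12RegularSpaces111Gauge.satisfiesI_III_act_iff`
with its three model hypotheses discharged. [cite: Balaban1987RG1, (3.29) p.276] -/
theorem satisfiesI_III_act_iff_unitary {F : Frame P i 𝔸} {c : StepConsts} {α₀ α₁ γ₀ : ℝ} (Φ : FieldPair P i 𝔸ˣ 𝔸)
    {v : Site P i → 𝔸ˣ} (hv : ∀ x, (v x : 𝔸) ∈ unitary 𝔸) :
    SatisfiesI_III (unitaryModel 𝔸) F c α₀ α₁ γ₀ (act v Φ) ↔ SatisfiesI_III (unitaryModel 𝔸) F c α₀ α₁ γ₀ Φ :=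
  satisfiesI_III_act_iff unitaryModel_norm_le unitaryModel_G_le_Gc unitaryModel_gc_conj Φ hv

/-- **(3.16) is invariant under `U(N)`-valued gauge transformations** — `B12RegularSpaces111Gauge.act_mem_space316_iff`, hypothesis-free.
[cite: Balaban1987RG1, (3.16) p.273] -/
theorem act_mem_space316_iff_unitary {Fj : Frame P i 𝔸} {cj : StepConsts} {Fk : Frame P i 𝔸} {ck : StepConsts} {β α₀ α₁ : ℝ}
    (Φ : FieldPair P i 𝔸ˣ 𝔸) {v : Site P i → 𝔸ˣ} (hv : ∀ x, (v x : 𝔸) ∈ unitary 𝔸) :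
    act v Φ ∈ space316 (unitaryModel 𝔸) Fj cj Fk ck β α₀ α₁ ↔ Φ ∈ space316 (unitaryModel 𝔸) Fj cj Fk ck β α₀ α₁ :=
  act_mem_space316_iff unitaryModel_norm_le unitaryModel_G_le_Gc unitaryModel_gc_conj Φ hv

/-- **The near-`G` clause of (3.29), sharp constants, in the `U(N)`-type model** — `B12Spaces329NearSharp.satisfiesI_III_act_near_sharp` with
ALL SIX model hypotheses discharged: for `(𝐔, 𝐉)` satisfying (i)–(iii) with `(α₀, α₁, γ₀)` on the whole lattice and `v = w·exp(iξE)`, `w`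
unitary-valued, `|E| ≤ δ₀`, `|∇^ξ_𝐔E| ≤ δ₁`, `ξ(α₁ + 2δ₀) ≤ 1/16`, the pair `(𝐔, 𝐉)^v` satisfies (i)–(iii) with any `α₀′ ≥ e^{2ξδ₀}α₀`,
`γ₀′ ≥ e^{2ξδ₀}γ₀`, `α₁′ ≥ α₁ + (3 + 12α₁ + 3ξα₀)δ₀ + 4δ₁`. [cite: Balaban1987RG1, (3.29) p.276] -/
theorem satisfiesI_III_act_near_sharp_unitary {F : Frame P i 𝔸} (hXb : ∀ b, b ∈ F.X.bonds) (hXp : ∀ p, p ∈ F.X.plaqs)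
    {c : StepConsts} (hξ : 0 < c.ξ) (hcB : 0 ≤ c.cB) {α₀ α₁ γ₀ δ₀ δ₁ α₀' α₁' γ₀' : ℝ} (hα₀ : 0 ≤ α₀) (hα₁ : 0 ≤ α₁)
    (hδ₁ : 0 ≤ δ₁) (hs : c.ξ * (α₁ + 2 * δ₀) ≤ 1 / 16) (hα₀' : Real.exp (2 * (c.ξ * δ₀)) * α₀ ≤ α₀')
    (hγ₀' : Real.exp (2 * (c.ξ * δ₀)) * γ₀ ≤ γ₀') (hα₁' : α₁ + (3 + 12 * α₁ + 3 * c.ξ * α₀) * δ₀ + 4 * δ₁ ≤ α₁')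
    {Φ : FieldPair P i 𝔸ˣ 𝔸} (h : SatisfiesI_III (unitaryModel 𝔸) F c α₀ α₁ γ₀ Φ)
    {w : Site P i → 𝔸ˣ} (hw : ∀ x, (w x : 𝔸) ∈ unitary 𝔸) {E : Site P i → 𝔸} (hE0 : ∀ x, ‖E x‖ ≤ δ₀)
    (hE1 : ∀ x μ, ‖nabla c.ξ Φ.U μ E x‖ ≤ δ₁) :
    SatisfiesI_III (unitaryModel 𝔸) F c α₀' α₁' γ₀' (act (w * fun x => expI c.ξ (E x)) Φ) :=
  satisfiesI_III_act_near_sharp unitaryModel_norm_le unitaryModel_G_le_Gc unitaryModel_gc_conj unitaryModel_gc_newPot hXb hXp hξ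
    hcB hα₀ hα₁ hδ₁ hs hα₀' hγ₀' hα₁' h hw (unitaryModel_gcValued E) (unitaryModel_expI_mem_Gc c.ξ E)
    (unitaryModel_gc_conjE c.ξ E) hE0 hE1

/-- **«A sufficiently small neighborhood of G-valued transformations», `U(N)`-type model, hypothesis-free**: for every target
`α₀′ > α₀`, `α₁′ > α₁`, `γ₀′ > γ₀` (and `ξα₁ < 1/16`) there is `δ > 0` such that every `v = w·exp(iξE)` with `w` unitary-valued and `|E| ≤ δ`,
`|∇^ξ_𝐔E| ≤ δ` carries the pairs satisfying (i)–(iii) with `(α₀, α₁, γ₀)` into those with `(α₀′, α₁′, γ₀′)`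
(`B12Spaces329NearSharp.exists_neighbourhood`). [cite: Balaban1987RG1, (3.29) p.276] -/
theorem exists_neighbourhood_unitary {F : Frame P i 𝔸} (hXb : ∀ b, b ∈ F.X.bonds) (hXp : ∀ p, p ∈ F.X.plaqs) {c : StepConsts}
    (hξ : 0 < c.ξ) (hcB : 0 ≤ c.cB) {α₀ α₁ γ₀ α₀' α₁' γ₀' : ℝ} (hα₀ : 0 ≤ α₀) (hα₁ : 0 ≤ α₁) (hγ₀ : 0 ≤ γ₀)
    (hξα : c.ξ * α₁ < 1 / 16) (hα₀' : α₀ < α₀') (hα₁' : α₁ < α₁') (hγ₀' : γ₀ < γ₀') :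
    ∃ δ : ℝ, 0 < δ ∧ ∀ {Φ : FieldPair P i 𝔸ˣ 𝔸}, SatisfiesI_III (unitaryModel 𝔸) F c α₀ α₁ γ₀ Φ →
      ∀ {w : Site P i → 𝔸ˣ}, (∀ x, (w x : 𝔸) ∈ unitary 𝔸) → ∀ {E : Site P i → 𝔸},
        (∀ x, ‖E x‖ ≤ δ) → (∀ x μ, ‖nabla c.ξ Φ.U μ E x‖ ≤ δ) →
          SatisfiesI_III (unitaryModel 𝔸) F c α₀' α₁' γ₀' (act (w * fun x => expI c.ξ (E x)) Φ) := by
  obtain ⟨δ, hδ, hmain⟩ := exists_neighbourhood unitaryModel_norm_le unitaryModel_G_le_Gc unitaryModel_gc_conj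
    unitaryModel_gc_newPot hXb hXp hξ hcB hα₀ hα₁ hγ₀ hξα hα₀' hα₁' hγ₀' (𝓜 := unitaryModel 𝔸) (F := F)
  exact ⟨δ, hδ, fun h w hw E hE0 hE1 =>
    hmain h hw (unitaryModel_gcValued E) (unitaryModel_expI_mem_Gc c.ξ E) (unitaryModel_gc_conjE c.ξ E) hE0 hE1⟩

/-- **(1.34) is invariant under `U(N)`-valued gauge transformations** — `B13Space134.act329_mem_space134_iff`, hypothesis-free
([Balaban1988RG2Cluster] Lemma 2, the gauge clause for the space). [cite: Balaban1988RG2Cluster, Lemma 2 p.11] -/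
theorem act329_mem_space134_iff_unitary {F : Frame P i 𝔸} {c : StepConsts} {β α₀ α₁ ε₁ g : ℝ}
    (Ψ : FieldPair P i 𝔸ˣ 𝔸 × (PBond P i → 𝔸)) {u : Site P i → 𝔸ˣ} (hu : ∀ x, (u x : 𝔸) ∈ unitary 𝔸) :
    act329 u Ψ ∈ space134 (unitaryModel 𝔸) F c β α₀ α₁ ε₁ g ↔ Ψ ∈ space134 (unitaryModel 𝔸) F c β α₀ α₁ ε₁ g :=
  act329_mem_space134_iff unitaryModel_norm_le unitaryModel_G_le_Gc Ψ hu

end Corollaries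

/-! ## §4. Print's letters: `𝔸 = M_N(ℂ)` with the operator norm, `G = U(N)` -/

section Matrices

open scoped Matrix.Norms.L2Operator

/-- For `𝔸 = M_N(ℂ)` with the `L²`-operator norm (scope `Matrix.Norms.L2Operator`: a C⋆-algebra structure, cf. `MatrixNorms`,
`B10Eq29TubeLine.cstarAlgebraMatrix`) the model's `G` consists exactly of the units whose matrix lies in `U(N) = Matrix.unitaryGroup`.
[cite: Balaban1987RG1, p.252] -/
theorem mem_G_iff_unitaryGroup {N : ℕ} (u : (Matrix (Fin N) (Fin N) ℂ)ˣ) :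
    u ∈ (unitaryModel (Matrix (Fin N) (Fin N) ℂ)).G ↔ (u : Matrix (Fin N) (Fin N) ℂ) ∈ Matrix.unitaryGroup (Fin N) ℂ :=
  Iff.rfl

/-- … and every element of `U(N)` is a unit lying in `G` (`U ↦ ⟨U, U⋆⟩`). [cite: Balaban1987RG1, p.252] -/
theorem toUnits_mem_G {N : ℕ} (U : Matrix.unitaryGroup (Fin N) ℂ) :
    Unitary.toUnits U ∈ (unitaryModel (Matrix (Fin N) (Fin N) ℂ)).G := by
  rw [mem_G_iff_unitaryGroup]
  exact U.2

/-- `hG1` in print's letters: `|U| ≤ 1` (operator norm) for `U ∈ U(N)`. [cite: Balaban1987RG1, p.252] -/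
theorem norm_le_one_of_mem_unitaryGroup {N : ℕ} {U : Matrix (Fin N) (Fin N) ℂ} (hU : U ∈ Matrix.unitaryGroup (Fin N) ℂ) :
    ‖U‖ ≤ 1 := by
  rcases subsingleton_or_nontrivial (Matrix (Fin N) (Fin N) ℂ) with h | h
  · rw [Subsingleton.elim U 0, norm_zero]; exact zero_le_one
  · exact (CStarRing.norm_of_mem_unitary hU).le

end Matrices

end

end Literature.MathematicalPhysics.QuantumFieldTheory.Balaban1983to89.B12RegularSpaces111Unitary
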